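import Mathlib.NumberTheory.Padics.HeightOneSpectrum
import Mathlib.NumberTheory.EulerProduct.Basic
import Mathlib.NumberTheory.LSeries.Dirichlet
import Mathlib.NumberTheory.LSeries.Injectivity
import Literature.NumberTheory.GaloisRepresentations.ArtinLFunctionNonvanishingProofs
import HarnessLib

/-!
# The Artin L-function of a representation of `Γ_ℚ` of dimension `≤ 2` is a Dirichlet series
# with multiplicative coefficients (pure proofs; companion to
`Literature.NumberTheory.GaloisRepresentations.ArtinLFunction`)

For an Artin representation `ρ : Γ_ℚ → GL(V)` over `ℚ` with `dim V ≤ 2` (e.g. a framed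
`σ : Γ_ℚ → GL₂(ℂ)`), the tree's Artin L-function `L(s, ρ) = ∏_v det(1 - Frob_v N v^{-s} | V^{I_v})⁻¹`
(`artinLFunction`, a `tprod` over the finite places `v` of `ℚ`) is, on `re s > 1`, the sum of an
absolutely convergent Dirichlet series `∑ a(n) n^{-s}` whose coefficient sequence `a` is
multiplicative on coprime arguments, normalised (`a 1 = 1`, `a 0 = 0`) and bounded by the
divisor function, `|a(n)| ≤ d(n)`:

* `ArtinRep.exists_LSeries_eq_artinLFunction_of_finrank_le_two`, and for framed `σ : Γ_ℚ → GL₂(ℂ)`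
  `FramedArtinRep.exists_LSeries_eq_artinLFunction_two`;
* `ArtinRep.eq_of_LSeries_eq_artinLFunction_of_finrank_le_two`: conversely ANY `a` with
  `∑ a(n) n^{-s} = L(s, ρ)` on `re s > 1` (Mathlib `LSeries`, junk value `0` where divergent)
  agrees with that multiplicative sequence at every `n ≥ 1` (`L(s, ρ) ≠ 0` on `re s > 1`,
  `artinLFunction_ne_zero_of_one_lt_re`, forces absolute convergence; then Mathlib's injectivity
  of `LSeries`, `LSeries.eq_of_LSeries_eventually_eq`).  This is the form in which routes and
  the named fact `Literature.NumberTheory.LFunctions.Booker2003_lemma1` introduce "the Dirichlet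
  coefficients `aₙ` of `L(s, ρ)`" (`∀ s, 1 < re s → LSeries a s = artinLFunction σ s`); in
  particular that hypothesis is satisfiable and pins `a` down on `n ≥ 1`.

Proof (Deligne–Serre, *Formes modulaires de poids 1*, Ann. Sci. ÉNS 7 (1974), §9, proof of
Thm. 9.1 / Cor. 9.2, for the coefficients of an Euler product of degree `2` with unitary inverse
roots: "`a_n = λ^m + λ^{m-1} μ + … + μ^m`, d'où `|a_n| ≤ m + 1`", "`∑ |a_n| n^{-σ} ≤ ∑ d(n) n^{-σ} < ∞`
pour `σ > 1`"; Diamond–Shurman, *A First Course in Modular Forms*, Thm. 5.9.2 and its proof,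
(5.24)–(5.26), for the passage between the recursion `a_{p^{r+2}} = a_p a_{p^{r+1}} - e_p a_{p^r}`
and the Euler factor `(1 - a_p p^{-s} + e_p p^{-2s})⁻¹`).  The image of `ρ` is finite
(`ArtinRep.finite_range_holds`), so each Euler factor is `∏_{β ∈ B_v} (1 - β T)` with at most
`dim V ≤ 2` inverse roots `β`, all of absolute value `1`
(`ArtinRep.exists_card_le_eval_eulerFactorAt_eq_prod`); padding with zeros,
`L_v(ρ, T) = (1 - λ_p T)(1 - μ_p T)`, `|λ_p|, |μ_p| ≤ 1`, `p` the prime under `v`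
(Mathlib `Rat.HeightOneSpectrum.primesEquiv`).  Put `a(p^r) = h_r(λ_p, μ_p) = ∑_{i+j=r} λ_p^i μ_p^j`
(`eulerCoeffTwo`) and extend multiplicatively (`multiplicativeExtension`); then `|a(p^r)| ≤ r + 1`,
`|a(n)| ≤ d(n)`, `∑ d(n) n^{-σ} = ζ(σ)² < ∞`, and Mathlib's Euler product for multiplicative
functions (`EulerProduct.eulerProduct_hasProd`) with `∑_r h_r x^r (1 - (λ+μ) x + λμ x²) = 1`
gives `∑ a(n) n^{-s} = ∏_p ((1 - λ_p p^{-s})(1 - μ_p p^{-s}))⁻¹ = L(s, ρ)` (`N v = p`).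

The generic lemmas `tsum_mul_eq_one_of_recurrence`, `LSeries_hasProd_of_recurrence`,
`summable_norm_term_card_divisors` and `N v = p` exist in
`Literature.NumberTheory.Automorphic.LanglandsTunnellLSeriesProofs` / `HeckeCharacterProofs`;
they are re-proved here as private lemmas so that this `GaloisRepresentations` file does not
import the modular-forms cone (same device as `ArtinLFunctionContinuationFE`).

## References

* P. Deligne, J.-P. Serre, *Formes modulaires de poids 1*, Ann. Sci. ÉNS (4) 7 (1974), §9,
  Thm. 9.1 and Cor. 9.2 with proof. [DeligneSerreASENS1974]
* F. Diamond, J. Shurman, *A First Course in Modular Forms*, GTM 228 (2005), Thm. 5.9.2 and its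
  proof, (5.24)–(5.26). [DiamondShurman2005]
* J. Neukirch, *Algebraic Number Theory* (1999), VII §10, (10.1) and the remark following it.
  [NeukirchANT1999]
-/

noncomputable section

open scoped NumberField
open Field IsDedekindDomain Module NumberField Polynomial Complex Filter

namespace Literature.NumberTheory.GaloisRepresentations

/-! ### The prime under a finite place of `ℚ` -/

/-- `N v = p`: the residue field of the finite place `v` of `ℚ` has `p` elements, `p` the prime
under `v` (`Rat.HeightOneSpectrum.primesEquiv v`).  (The tree's
`Rat.residueCard_eq_natGenerator` of `HeckeCharacterProofs`, re-proved to keep the imports of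
this file inside the Galois-representations topic.) [folklore] -/
private theorem residueCard_eq_coe_primesEquiv (v : HeightOneSpectrum (𝓞 ℚ)) :
    v.residueCard = ((Rat.HeightOneSpectrum.primesEquiv v : Nat.Primes) : ℕ) := by
  rw [v.residueCard_eq_card_quotient]
  have h : Ideal.span {(Rat.HeightOneSpectrum.natGenerator v : ℤ)} =
      v.asIdeal.map (Rat.IsIntegralClosure.intEquiv (𝓞 ℚ) : 𝓞 ℚ →+* ℤ) :=
    Rat.HeightOneSpectrum.span_natGenerator v
  rw [Nat.card_congr ((Ideal.quotientEquiv _ _ (Rat.IsIntegralClosure.intEquiv (𝓞 ℚ)) h).trans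
    (Int.quotientSpanNatEquivZMod _)).toEquiv, Nat.card_zmod]
  rfl

/-! ### Euler factors of degree at most two: padding the inverse roots -/

/-- From a multiset `B` of at most two complex numbers of absolute value `1` one gets a pair
`(λ, μ)` with `|λ|, |μ| ≤ 1` and `∏_{β ∈ B} (1 - β z) = (1 - λ z)(1 - μ z)` for all `z` (pad with
zeros).  Deligne–Serre 1974, proof of Thm. 4.6 (iv): "`b_p`, `c_p` sont, soit `0`, soit des
racines de l'unité". [cite: DeligneSerreASENS1974, §4 proof of Thm. 4.6 (iv)] -/
theorem exists_pair_of_card_le_two {B : Multiset ℂ} (hB : Multiset.card B ≤ 2)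
    (hn : ∀ β ∈ B, ‖β‖ = 1) :
    ∃ l m : ℂ, ‖l‖ ≤ 1 ∧ ‖m‖ ≤ 1 ∧
      ∀ z : ℂ, (B.map fun β => 1 - β * z).prod = (1 - l * z) * (1 - m * z) := by
  have hcases : Multiset.card B = 0 ∨ Multiset.card B = 1 ∨ Multiset.card B = 2 := by omega
  rcases hcases with h0 | h1 | h2
  · rw [Multiset.card_eq_zero] at h0
    subst h0
    exact ⟨0, 0, by simp, by simp, fun z => by simp⟩
  · rw [Multiset.card_eq_one] at h1
    obtain ⟨β, rfl⟩ := h1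
    exact ⟨β, 0, (hn β (Multiset.mem_singleton_self β)).le, by simp, fun z => by simp⟩
  · rw [Multiset.card_eq_two] at h2
    obtain ⟨β, γ, rfl⟩ := h2
    exact ⟨β, γ, (hn β (by simp)).le, (hn γ (by simp)).le, fun z => by simp⟩

/-! ### The prime-power coefficients `h_r(λ, μ) = ∑_{i+j=r} λ^i μ^j` -/

/-- The **complete homogeneous coefficients** `h_r(λ, μ) = ∑_{i=0}^{r} λ^i μ^{r-i}` — the
coefficients of `1/((1 - λT)(1 - μT)) = ∑_r h_r(λ, μ) T^r`, i.e. the Dirichlet coefficients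
`a_{p^r}` of a degree-two Euler factor with inverse roots `λ, μ` (Deligne–Serre 1974, proof of
Thm. 9.1: "`a_n = λ^m + λ^{m-1} μ + … + μ^m`"). [cite: DeligneSerreASENS1974, §9 proof of Thm. 9.1] -/
def eulerCoeffTwo (l m : ℂ) (r : ℕ) : ℂ :=
  ∑ i ∈ Finset.range (r + 1), l ^ i * m ^ (r - i)

/-- `h₀ = 1`. [folklore] -/
theorem eulerCoeffTwo_zero (l m : ℂ) : eulerCoeffTwo l m 0 = 1 := by
  simp [eulerCoeffTwo]

/-- The one-step recursion `h_{r+1} = λ h_r + μ^{r+1}`. [folklore] -/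
theorem eulerCoeffTwo_succ (l m : ℂ) (r : ℕ) :
    eulerCoeffTwo l m (r + 1) = l * eulerCoeffTwo l m r + m ^ (r + 1) := by
  unfold eulerCoeffTwo
  rw [Finset.sum_range_succ', Finset.mul_sum]
  simp only [pow_zero, one_mul, Nat.sub_zero]
  congr 1
  refine Finset.sum_congr rfl fun i hi => ?_
  have hi' : i ≤ r := Nat.lt_succ_iff.mp (Finset.mem_range.mp hi)
  have : r + 1 - (i + 1) = r - i := by omega
  rw [this, pow_succ]
  ring

/-- `h₁ = λ + μ`. [folklore] -/
theorem eulerCoeffTwo_one (l m : ℂ) : eulerCoeffTwo l m 1 = l + m := by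
  rw [eulerCoeffTwo_succ, eulerCoeffTwo_zero, pow_one, mul_one]

/-- The **Hecke recursion** `h_{r+2} = (λ + μ) h_{r+1} - λμ h_r` (Diamond–Shurman, proof of
Thm. 5.9.2, (5.24)). [cite: DiamondShurman2005, proof of Thm. 5.9.2, (5.24)] -/
theorem eulerCoeffTwo_add_two (l m : ℂ) (r : ℕ) :
    eulerCoeffTwo l m (r + 2) = (l + m) * eulerCoeffTwo l m (r + 1) - l * m * eulerCoeffTwo l m r := by
  rw [show r + 2 = r + 1 + 1 from rfl, eulerCoeffTwo_succ, eulerCoeffTwo_succ]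
  ring

/-- **`|h_r(λ, μ)| ≤ r + 1` for `|λ|, |μ| ≤ 1`** (Deligne–Serre 1974, proof of Thm. 9.1: "d'où
`|a_n| ≤ m + 1`"; here also for the padded zeros). [cite: DeligneSerreASENS1974, §9 proof of Thm. 9.1] -/
theorem norm_eulerCoeffTwo_le {l m : ℂ} (hl : ‖l‖ ≤ 1) (hm : ‖m‖ ≤ 1) (r : ℕ) :
    ‖eulerCoeffTwo l m r‖ ≤ r + 1 := by
  induction r with
  | zero => simp [eulerCoeffTwo_zero]
  | succ r ih =>
    rw [eulerCoeffTwo_succ]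
    have h1 : ‖l * eulerCoeffTwo l m r‖ ≤ ‖eulerCoeffTwo l m r‖ := by
      rw [norm_mul]
      calc ‖l‖ * ‖eulerCoeffTwo l m r‖ ≤ 1 * ‖eulerCoeffTwo l m r‖ := by gcongr
        _ = ‖eulerCoeffTwo l m r‖ := one_mul _
    have h2 : ‖m ^ (r + 1)‖ ≤ 1 := by
      rw [norm_pow]
      exact pow_le_one₀ (norm_nonneg _) hm
    calc ‖l * eulerCoeffTwo l m r + m ^ (r + 1)‖
        ≤ ‖l * eulerCoeffTwo l m r‖ + ‖m ^ (r + 1)‖ := norm_add_le _ _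
      _ ≤ ‖eulerCoeffTwo l m r‖ + 1 := add_le_add h1 h2
      _ ≤ (r + 1) + 1 := by gcongr
      _ = ((r + 1 : ℕ) : ℝ) + 1 := by push_cast; ring

/-! ### Multiplicative extension of prime-power data -/

/-- The **multiplicative function with prescribed prime-power values**: for `c : ℕ → ℕ → ℂ`
(`c p k` is used only for primes `p`), `multiplicativeExtension c 0 = 0` and
`multiplicativeExtension c n = ∏_{p ∣ n} c p (v_p(n))` for `n ≥ 1` (`Nat.factorization`). [folklore] -/
def multiplicativeExtension (c : ℕ → ℕ → ℂ) (n : ℕ) : ℂ :=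
  if n = 0 then 0 else n.factorization.prod c

/-- `multiplicativeExtension c 0 = 0`. [folklore] -/
theorem multiplicativeExtension_zero (c : ℕ → ℕ → ℂ) : multiplicativeExtension c 0 = 0 := by
  simp [multiplicativeExtension]

/-- `multiplicativeExtension c n = ∏_{p} c p (v_p n)` for `n ≠ 0`. [folklore] -/
theorem multiplicativeExtension_of_ne_zero (c : ℕ → ℕ → ℂ) {n : ℕ} (hn : n ≠ 0) :
    multiplicativeExtension c n = n.factorization.prod c := by
  simp [multiplicativeExtension, hn]

/-- `multiplicativeExtension c 1 = 1`. [folklore] -/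
theorem multiplicativeExtension_one (c : ℕ → ℕ → ℂ) : multiplicativeExtension c 1 = 1 := by
  rw [multiplicativeExtension_of_ne_zero c one_ne_zero, Nat.factorization_one,
    Finsupp.prod_zero_index]

/-- On prime powers: `multiplicativeExtension c (p^k) = c p k` (given `c p 0 = 1`). [folklore] -/
theorem multiplicativeExtension_prime_pow (c : ℕ → ℕ → ℂ) {p : ℕ} (hp : p.Prime)
    (hc : c p 0 = 1) (k : ℕ) : multiplicativeExtension c (p ^ k) = c p k := by
  rw [multiplicativeExtension_of_ne_zero c (pow_ne_zero k hp.ne_zero), hp.factorization_pow,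
    Finsupp.prod_single_index hc]

/-- Multiplicativity on coprime arguments. [folklore] -/
theorem multiplicativeExtension_mul_of_coprime (c : ℕ → ℕ → ℂ) {m n : ℕ} (hmn : m.Coprime n) :
    multiplicativeExtension c (m * n) =
      multiplicativeExtension c m * multiplicativeExtension c n := by
  rcases eq_or_ne m 0 with rfl | hm
  · simp [multiplicativeExtension_zero]
  rcases eq_or_ne n 0 with rfl | hn
  · simp [multiplicativeExtension_zero]
  rw [multiplicativeExtension_of_ne_zero c (mul_ne_zero hm hn),
    multiplicativeExtension_of_ne_zero c hm, multiplicativeExtension_of_ne_zero c hn,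
    Nat.factorization_mul_of_coprime hmn]
  refine Finsupp.prod_add_index_of_disjoint ?_ c
  rw [Nat.support_factorization, Nat.support_factorization]
  exact hmn.disjoint_primeFactors

/-- **`|a(n)| ≤ d(n)`**: if `|c p k| ≤ k + 1` at every prime `p`, the multiplicative extension is
bounded by the number of divisors (`d(n) = ∏_p (v_p(n) + 1)`, Mathlib `Nat.card_divisors`).
Deligne–Serre 1974, Cor. 9.2 / proof of Thm. 9.1. [cite: DeligneSerreASENS1974, §9 proof of Thm. 9.1] -/
theorem norm_multiplicativeExtension_le_card_divisors (c : ℕ → ℕ → ℂ)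
    (hc : ∀ p : ℕ, p.Prime → ∀ k : ℕ, ‖c p k‖ ≤ k + 1) (n : ℕ) :
    ‖multiplicativeExtension c n‖ ≤ (n.divisors.card : ℝ) := by
  rcases eq_or_ne n 0 with rfl | hn
  · simp [multiplicativeExtension_zero]
  rw [multiplicativeExtension_of_ne_zero c hn, Nat.card_divisors hn, Finsupp.prod,
    Nat.support_factorization, norm_prod, Nat.cast_prod]
  refine Finset.prod_le_prod (fun p _ => norm_nonneg _) fun p hp => ?_
  have := hc p (Nat.prime_of_mem_primeFactors hp) (n.factorization p)
  push_cast
  exact this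

/-! ### Euler products of degree two (Diamond–Shurman (5.24)–(5.26)), private copies -/

/-- `(∑_r c_r x^r)(1 - a x + b x²) = 1` for `c₀ = 1`, `c₁ = a`, `c_{r+2} = a c_{r+1} - b c_r`
(the tree's `ModularForms.tsum_mul_eq_one_of_recurrence`, re-proved privately).
[cite: DiamondShurman2005, proof of Thm. 5.9.2, (5.24)] -/
private theorem tsum_mul_eq_one_of_recurrence' {a b x : ℂ} {c : ℕ → ℂ} (h0 : c 0 = 1)
    (h1 : c 1 = a) (hrec : ∀ r, c (r + 2) = a * c (r + 1) - b * c r)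
    (hs : Summable fun r ↦ c r * x ^ r) :
    (∑' r, c r * x ^ r) * (1 - a * x + b * x ^ 2) = 1 := by
  set u : ℕ → ℂ := fun r ↦ c r * x ^ r with hu
  have hs1 : Summable fun r ↦ u (r + 1) := (summable_nat_add_iff 1).mpr hs
  have e0 : ∑' r, u r = 1 + ∑' r, u (r + 1) := by
    rw [hs.tsum_eq_zero_add]
    simp [hu, h0]
  have e1 : ∑' r, u (r + 1) = a * x + ∑' r, u (r + 2) := by
    rw [hs1.tsum_eq_zero_add]
    simp [hu, h1]
  have e2 : ∑' r, u (r + 2) = a * x * ∑' r, u (r + 1) - b * x ^ 2 * ∑' r, u r := by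
    rw [← tsum_mul_left, ← tsum_mul_left, ← (hs1.mul_left _).tsum_sub (hs.mul_left _)]
    refine tsum_congr fun r ↦ ?_
    simp only [hu, hrec]
    ring
  change (∑' r, u r) * _ = 1
  linear_combination (1 - a * x) * e0 + e1 + e2

/-- Euler product of a Dirichlet series with Hecke-type coefficients (the tree's
`Automorphic.LSeries_hasProd_of_recurrence`, re-proved privately): `a 1 = 1`, `a` multiplicative
on coprime arguments, `a(p^{r+2}) = a(p) a(p^{r+1}) - e(p) a(p^r)`, `∑ a(n) n^{-s}` absolutely
convergent ⟹ `∑ a(n) n^{-s} = ∏_p (1 - a(p) p^{-s} + e(p) p^{-2s})⁻¹`.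
[cite: DiamondShurman2005, Thm. 5.9.2 and its proof] -/
private theorem LSeries_hasProd_of_recurrence' {a e : ℕ → ℂ} (h1 : a 1 = 1)
    (hmulc : ∀ {m n : ℕ}, m.Coprime n → a (m * n) = a m * a n)
    (hrec : ∀ {p : ℕ}, p.Prime → ∀ r : ℕ, a (p ^ (r + 2)) = a p * a (p ^ (r + 1)) - e p * a (p ^ r))
    {s : ℂ} (hs : LSeriesSummable a s) :
    HasProd (fun p : Nat.Primes ↦
      (1 - a p * (p : ℂ) ^ (-s) + e p * ((p : ℂ) ^ (-s)) ^ 2)⁻¹) (LSeries a s) := by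
  set G : ℕ → ℂ := LSeries.term a s with hG
  have hGn : ∀ {n : ℕ}, n ≠ 0 → G n = a n * (n : ℂ) ^ (-s) := fun hn ↦ by
    rw [hG, LSeries.term_of_ne_zero hn, div_eq_mul_inv, ← cpow_neg]
  have hG0 : G 0 = 0 := LSeries.term_zero a s
  have hG1 : G 1 = 1 := by rw [hGn one_ne_zero, h1, Nat.cast_one, one_cpow, mul_one]
  have hGmul : ∀ {m n : ℕ}, m.Coprime n → G (m * n) = G m * G n := by
    intro m n hmn
    rcases eq_or_ne m 0 with rfl | hm
    · rw [zero_mul, hG0, zero_mul]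
    rcases eq_or_ne n 0 with rfl | hn
    · rw [mul_zero, hG0, mul_zero]
    rw [hGn (mul_ne_zero hm hn), hGn hm, hGn hn, hmulc hmn, Nat.cast_mul,
      natCast_mul_natCast_cpow]
    ring
  have hsum : Summable fun n ↦ ‖G n‖ := summable_norm_iff.mpr hs
  have hEP := EulerProduct.eulerProduct_hasProd hG1 hGmul hsum hG0
  have hfactor : ∀ p : Nat.Primes, ∑' r : ℕ, G ((p : ℕ) ^ r) =
      (1 - a p * (p : ℂ) ^ (-s) + e p * ((p : ℂ) ^ (-s)) ^ 2)⁻¹ := by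
    intro p
    have hp : (p : ℕ).Prime := p.2
    have hGp : ∀ r : ℕ, G ((p : ℕ) ^ r) = a ((p : ℕ) ^ r) * ((p : ℂ) ^ (-s)) ^ r := fun r ↦ by
      rw [hGn (pow_ne_zero _ hp.ne_zero), Nat.cast_pow, ← natCast_cpow_natCast_mul,
        ← cpow_nat_mul]
    have hsx : Summable fun r : ℕ ↦ a ((p : ℕ) ^ r) * ((p : ℂ) ^ (-s)) ^ r := by
      have := hsum.of_norm.comp_injective (Nat.pow_right_injective hp.two_le)
      simpa only [Function.comp_def, hGp] using this
    have key := tsum_mul_eq_one_of_recurrence' (x := (p : ℂ) ^ (-s)) (a := a p)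
      (b := e p) (c := fun r ↦ a ((p : ℕ) ^ r))
      (by simp only [pow_zero, h1]) (by simp only [pow_one]) (hrec hp) hsx
    simp_rw [hGp]
    exact eq_inv_of_mul_eq_one_left key
  rw [LSeries, show (fun p : Nat.Primes ↦ (1 - a p * (p : ℂ) ^ (-s) +
      e p * ((p : ℂ) ^ (-s)) ^ 2)⁻¹) = fun p : Nat.Primes ↦ ∑' r : ℕ, G ((p : ℕ) ^ r) from
      funext fun p ↦ (hfactor p).symm]
  exact hEP

/-- `∑ d(n) n^{-s}` converges absolutely for `re s > 1` (`= ζ(s)²`; the tree's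
`ModularForms.summable_norm_term_card_divisors`, re-proved privately). [folklore] -/
private theorem summable_norm_term_card_divisors' {s : ℂ} (hs : 1 < s.re) :
    Summable fun n : ℕ ↦ ‖LSeries.term (fun n ↦ (n.divisors.card : ℂ)) s n‖ := by
  have hζ : LSeriesSummable (fun n ↦ ((ArithmeticFunction.zeta : ArithmeticFunction ℂ) n : ℂ))
      s := by
    refine (LSeriesSummable_congr s fun {n} _ ↦ ?_).mp
      (ArithmeticFunction.LSeriesSummable_zeta_iff.mpr hs)
    simp [ArithmeticFunction.natCoe_apply]
  have hmul := ArithmeticFunction.LSeriesSummable_mul hζ hζ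
  have heq : ∀ n : ℕ, (((ArithmeticFunction.zeta : ArithmeticFunction ℂ) *
      (ArithmeticFunction.zeta : ArithmeticFunction ℂ)) n : ℂ) = (n.divisors.card : ℂ) := by
    intro n
    rw [ArithmeticFunction.coe_zeta_mul_apply, Finset.card_eq_sum_ones, Nat.cast_sum]
    refine Finset.sum_congr rfl fun i hi ↦ ?_
    rw [ArithmeticFunction.natCoe_apply,
      ArithmeticFunction.zeta_apply_ne (Nat.pos_of_mem_divisors hi).ne']
  have hmul' : LSeriesSummable (fun n ↦ (n.divisors.card : ℂ)) s :=
    (LSeriesSummable_congr s fun {n} _ ↦ heq n).mp hmul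
  exact summable_norm_iff.mpr hmul'

/-- A sequence bounded by the divisor function has absolutely convergent Dirichlet series on
`re s > 1` (Deligne–Serre 1974, Cor. 9.2: "converge absolument pour `R(s) > 1`").
[cite: DeligneSerreASENS1974, Cor. 9.2] -/
theorem lseriesSummable_of_norm_le_card_divisors {a : ℕ → ℂ}
    (ha : ∀ n, ‖a n‖ ≤ (n.divisors.card : ℝ)) {s : ℂ} (hs : 1 < s.re) : LSeriesSummable a s := by
  refine Summable.of_norm_bounded (summable_norm_term_card_divisors' hs) fun n => ?_
  rcases eq_or_ne n 0 with rfl | hn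
  · simp [LSeries.term_zero]
  · rw [LSeries.term_of_ne_zero hn, LSeries.term_of_ne_zero hn, norm_div, norm_div,
      Complex.norm_natCast]
    gcongr
    exact ha n

/-! ### The main results -/

section Main

variable {V : Type*} [AddCommGroup V] [Module ℂ V] [TopologicalSpace V] [FiniteDimensional ℂ V]
  [IsModuleTopology ℂ V]

/-- **The Artin L-function of `ρ : Γ_ℚ → GL(V)`, `dim V ≤ 2`, is a Dirichlet series with
multiplicative coefficients bounded by `d(n)`.**  There is `a : ℕ → ℂ` with `a 0 = 0`, `a 1 = 1`,
`a(mn) = a(m) a(n)` for coprime `m, n`, `|a(n)| ≤ d(n)`, and for every `s` with `re s > 1` the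
series `∑ a(n) n^{-s}` converges absolutely with sum `L(s, ρ)` (`artinLFunction ρ s`).
Construction: `a(p^r) = h_r(λ_p, μ_p)` (`eulerCoeffTwo`) for the (zero-padded) inverse roots
`λ_p, μ_p` of the Euler factor at the place over `p`, extended multiplicatively
(`multiplicativeExtension`); Deligne–Serre 1974, §9 (Thm. 9.1, Cor. 9.2) for the estimates,
Diamond–Shurman Thm. 5.9.2 for the Euler product, Neukirch VII (10.1) for `L(s, ρ)`.
[cite: DeligneSerreASENS1974, §9 Thm. 9.1 and Cor. 9.2] -/
theorem ArtinRep.exists_LSeries_eq_artinLFunction_of_finrank_le_two (ρ : ArtinRep ℚ V)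
    (hV : finrank ℂ V ≤ 2) :
    ∃ a : ℕ → ℂ, a 0 = 0 ∧ a 1 = 1 ∧ (∀ m n : ℕ, m.Coprime n → a (m * n) = a m * a n) ∧
      (∀ n : ℕ, ‖a n‖ ≤ (n.divisors.card : ℝ)) ∧
      ∀ s : ℂ, 1 < s.re → LSeriesSummable a s ∧ LSeries a s = artinLFunction ρ s := by
  have hfin : (Set.range (ρ : absoluteGaloisGroup ℚ → V →ₗ[ℂ] V)).Finite :=
    ArtinRep.finite_range_holds ρ
  -- local data: the padded inverse roots at the place over each prime
  have hloc : ∀ p : Nat.Primes, ∃ lm : ℂ × ℂ, ‖lm.1‖ ≤ 1 ∧ ‖lm.2‖ ≤ 1 ∧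
      ∀ z : ℂ, (ρ.eulerFactorAt ((Rat.HeightOneSpectrum.primesEquiv (R := 𝓞 ℚ)).symm p)).eval z =
        (1 - lm.1 * z) * (1 - lm.2 * z) := by
    intro p
    obtain ⟨B, hcard, hnorm, heval⟩ := ρ.exists_card_le_eval_eulerFactorAt_eq_prod hfin
      ((Rat.HeightOneSpectrum.primesEquiv (R := 𝓞 ℚ)).symm p)
    obtain ⟨l, m, hl, hm, hlm⟩ := exists_pair_of_card_le_two (hcard.trans hV) hnorm
    exact ⟨(l, m), hl, hm, fun z => by rw [heval, hlm]⟩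
  choose lm hl hm hfac using hloc
  -- the coefficients on prime powers and their multiplicative extension
  let c : ℕ → ℕ → ℂ := fun p k =>
    if hp : p.Prime then eulerCoeffTwo (lm ⟨p, hp⟩).1 (lm ⟨p, hp⟩).2 k else 1
  have hcp : ∀ {p : ℕ} (hp : p.Prime) (k : ℕ),
      c p k = eulerCoeffTwo (lm ⟨p, hp⟩).1 (lm ⟨p, hp⟩).2 k := fun hp k => by
    simp only [c, dif_pos hp]
  have hc0 : ∀ p, c p 0 = 1 := fun p => by
    by_cases hp : p.Prime
    · rw [hcp hp, eulerCoeffTwo_zero]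
    · simp only [c, dif_neg hp]
  let e : ℕ → ℂ := fun p => if hp : p.Prime then (lm ⟨p, hp⟩).1 * (lm ⟨p, hp⟩).2 else 0
  set a : ℕ → ℂ := multiplicativeExtension c with ha_def
  have ha1 : a 1 = 1 := multiplicativeExtension_one c
  have hamul : ∀ m n : ℕ, m.Coprime n → a (m * n) = a m * a n := fun m n hmn =>
    multiplicativeExtension_mul_of_coprime c hmn
  have happ : ∀ {p : ℕ} (hp : p.Prime) (k : ℕ),
      a (p ^ k) = eulerCoeffTwo (lm ⟨p, hp⟩).1 (lm ⟨p, hp⟩).2 k := fun hp k => by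
    rw [ha_def, multiplicativeExtension_prime_pow c hp (hc0 _), hcp hp]
  have hnorm : ∀ n, ‖a n‖ ≤ (n.divisors.card : ℝ) :=
    norm_multiplicativeExtension_le_card_divisors c (fun p hp k => by
      rw [hcp hp]
      exact norm_eulerCoeffTwo_le (hl ⟨p, hp⟩) (hm ⟨p, hp⟩) k)
  refine ⟨a, multiplicativeExtension_zero c, ha1, hamul, hnorm, fun s hs => ?_⟩
  have hsum : LSeriesSummable a s := lseriesSummable_of_norm_le_card_divisors hnorm hs
  refine ⟨hsum, ?_⟩
  -- the Euler product of `∑ a(n) n^{-s}` over the primes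
  have hrec : ∀ {p : ℕ}, p.Prime → ∀ r : ℕ,
      a (p ^ (r + 2)) = a p * a (p ^ (r + 1)) - e p * a (p ^ r) := by
    intro p hp r
    have h1 : a p = (lm ⟨p, hp⟩).1 + (lm ⟨p, hp⟩).2 := by
      have := happ hp 1
      rwa [pow_one, eulerCoeffTwo_one] at this
    rw [happ hp, happ hp, happ hp, h1, eulerCoeffTwo_add_two]
    simp only [e, dif_pos hp]
  have hEP := LSeries_hasProd_of_recurrence' (e := e) ha1 (fun {m n} hmn => hamul m n hmn)
    hrec hsum
  -- transport to the finite places of `ℚ`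
  have hF : HasProd (fun v : HeightOneSpectrum (𝓞 ℚ) =>
      ((ρ.eulerFactorAt v).eval ((v.residueCard : ℂ) ^ (-s)))⁻¹) (LSeries a s) := by
    rw [← Equiv.hasProd_iff (Rat.HeightOneSpectrum.primesEquiv (R := 𝓞 ℚ)).symm]
    have heq : ((fun v : HeightOneSpectrum (𝓞 ℚ) =>
        ((ρ.eulerFactorAt v).eval ((v.residueCard : ℂ) ^ (-s)))⁻¹) ∘
          (Rat.HeightOneSpectrum.primesEquiv (R := 𝓞 ℚ)).symm) =
        fun p : Nat.Primes => (1 - a p * (p : ℂ) ^ (-s) + e p * ((p : ℂ) ^ (-s)) ^ 2)⁻¹ := by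
      funext p
      have hp : (p : ℕ).Prime := p.2
      have h1 : a p = (lm p).1 + (lm p).2 := by
        have := happ hp 1
        rw [pow_one, eulerCoeffTwo_one, Subtype.coe_eta] at this
        exact this
      have h2 : e p = (lm p).1 * (lm p).2 := by
        simp only [e, dif_pos hp, Subtype.coe_eta]
      simp only [Function.comp_apply]
      rw [residueCard_eq_coe_primesEquiv, Equiv.apply_symm_apply, hfac p, h1, h2]
      congr 1
      ring
    rw [heq]
    exact hEP
  exact hF.tprod_eq.symm

/-- **Uniqueness of the Dirichlet coefficients of `L(s, ρ)`, `dim V ≤ 2`.**  If `a : ℕ → ℂ` is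
ANY sequence with `∑ a(n) n^{-s} = L(s, ρ)` for `re s > 1` (Mathlib `LSeries`, with its junk value
`0` where the series diverges), then `a` agrees on `n ≥ 1` with the multiplicative sequence of
`exists_LSeries_eq_artinLFunction_of_finrank_le_two`: `L(s, ρ) ≠ 0` on `re s > 1`
(`artinLFunction_ne_zero_of_one_lt_re`) forces the series of `a` to converge absolutely there,
and absolutely convergent Dirichlet series with the same sum have the same coefficients
(Mathlib `LSeries.eq_of_LSeries_eventually_eq`).  In particular `a` is multiplicative on coprime
non-zero arguments, `|a(n)| ≤ d(n)`, and `∑ a(n) n^{-s}` converges absolutely on `re s > 1`.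
[cite: DeligneSerreASENS1974, §9 Thm. 9.1 and Cor. 9.2] -/
theorem ArtinRep.eq_of_LSeries_eq_artinLFunction_of_finrank_le_two (ρ : ArtinRep ℚ V)
    (hV : finrank ℂ V ≤ 2) {a : ℕ → ℂ}
    (ha : ∀ s : ℂ, 1 < s.re → LSeries a s = artinLFunction ρ s) :
    ∃ b : ℕ → ℂ, b 0 = 0 ∧ b 1 = 1 ∧ (∀ m n : ℕ, m.Coprime n → b (m * n) = b m * b n) ∧
      (∀ n : ℕ, ‖b n‖ ≤ (n.divisors.card : ℝ)) ∧ (∀ n : ℕ, n ≠ 0 → a n = b n) ∧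
      ∀ s : ℂ, 1 < s.re → LSeriesSummable a s ∧ LSeriesSummable b s ∧
        LSeries b s = artinLFunction ρ s := by
  obtain ⟨b, hb0, hb1, hbmul, hbnorm, hbL⟩ :=
    ρ.exists_LSeries_eq_artinLFunction_of_finrank_le_two hV
  -- `a` is absolutely summable on `re s > 1` since `L(s, ρ) ≠ 0` there
  have hasum : ∀ s : ℂ, 1 < s.re → LSeriesSummable a s := by
    intro s hs
    by_contra h
    have h0 : LSeries a s = 0 := tsum_eq_zero_of_not_summable h
    exact artinLFunction_ne_zero_of_one_lt_re ρ hs ((ha s hs).symm.trans h0)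
  have habs : ∀ f : ℕ → ℂ, (∀ s : ℂ, 1 < s.re → LSeriesSummable f s) →
      LSeries.abscissaOfAbsConv f < ⊤ := by
    intro f hf
    refine lt_of_le_of_lt (LSeries.abscissaOfAbsConv_le_of_forall_lt_LSeriesSummable
      (x := 1) fun y hy => hf y ?_) (EReal.coe_lt_top 1)
    simpa using hy
  have hev : (fun x : ℝ => LSeries a x) =ᶠ[atTop] fun x => LSeries b x := by
    filter_upwards [eventually_gt_atTop (1 : ℝ)] with x hx
    have hx' : 1 < (x : ℂ).re := by simpa using hx
    rw [ha x hx', (hbL x hx').2]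
  refine ⟨b, hb0, hb1, hbmul, hbnorm, fun n hn => ?_, fun s hs => ⟨hasum s hs, (hbL s hs).1,
    (hbL s hs).2⟩⟩
  exact LSeries.eq_of_LSeries_eventually_eq (habs a hasum) (habs b fun s hs => (hbL s hs).1)
    hev hn

end Main

/-- **Framed form**: for `σ : Γ_ℚ → GL₂(ℂ)` there is a normalised multiplicative `a` with
`|a(n)| ≤ d(n)` and `∑ a(n) n^{-s} = L(s, σ)` absolutely convergent on `re s > 1` — in particular
the hypothesis "`LSeries a s = artinLFunction σ s` for `re s > 1`" of
`Literature.NumberTheory.LFunctions.Booker2003_lemma1` is satisfiable.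
[cite: DeligneSerreASENS1974, §9 Thm. 9.1 and Cor. 9.2] -/
theorem FramedArtinRep.exists_LSeries_eq_artinLFunction_two (σ : FramedArtinRep ℚ 2) :
    ∃ a : ℕ → ℂ, a 0 = 0 ∧ a 1 = 1 ∧ (∀ m n : ℕ, m.Coprime n → a (m * n) = a m * a n) ∧
      (∀ n : ℕ, ‖a n‖ ≤ (n.divisors.card : ℝ)) ∧
      ∀ s : ℂ, 1 < s.re → LSeriesSummable a s ∧ LSeries a s = artinLFunction σ.toArtinRep s :=
  σ.toArtinRep.exists_LSeries_eq_artinLFunction_of_finrank_le_two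
    (by rw [Module.finrank_fin_fun])

/-- **Framed uniqueness form** (the shape of the coefficient hypothesis of
`Literature.NumberTheory.LFunctions.Booker2003_lemma1` and of route `EvenArtinQuantumBoundary`):
any `a` with `LSeries a s = artinLFunction σ s` on `re s > 1` is, on `n ≥ 1`, the multiplicative
divisor-bounded coefficient sequence of `L(s, σ)`, and its Dirichlet series converges absolutely
on `re s > 1`. [cite: DeligneSerreASENS1974, §9 Thm. 9.1 and Cor. 9.2] -/
theorem FramedArtinRep.eq_of_LSeries_eq_artinLFunction_two (σ : FramedArtinRep ℚ 2) {a : ℕ → ℂ}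
    (ha : ∀ s : ℂ, 1 < s.re → LSeries a s = artinLFunction σ.toArtinRep s) :
    ∃ b : ℕ → ℂ, b 0 = 0 ∧ b 1 = 1 ∧ (∀ m n : ℕ, m.Coprime n → b (m * n) = b m * b n) ∧
      (∀ n : ℕ, ‖b n‖ ≤ (n.divisors.card : ℝ)) ∧ (∀ n : ℕ, n ≠ 0 → a n = b n) ∧
      ∀ s : ℂ, 1 < s.re → LSeriesSummable a s ∧ LSeriesSummable b s ∧
        LSeries b s = artinLFunction σ.toArtinRep s :=
  σ.toArtinRep.eq_of_LSeries_eq_artinLFunction_of_finrank_le_two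
    (by rw [Module.finrank_fin_fun]) ha

end Literature.NumberTheory.GaloisRepresentations

end
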